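import Literature.MathematicalPhysics.QuantumFieldTheory.Balaban1983to89.DagBinding

/-!
# NODE 00 (YM-PLAN Track A) — WORLD FRAME: which fields of a binding world `w : DagBinding.WorldP` the thirteen
# paper nodes N01–N13 read, and what N09 ∕ N11 ∕ N13 reduce to once the carriers are pinned (Stage-5 companion)

NODE 00 CELL FILE (seat `pub-ymgap-node00-def`, g4, 2026-08-23; YM-PLAN §2a NODE 00, report NODE00-SCOPING.md §2.11–§2.12,
FIRST3-READINESS §3 N0-7 «the CONSTRUCTION `C` of record»).  Companion to `Node00CarriersFrame` (g3), which frames the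
carrier-only nodes N01–N08, N10, N12 over a Stage-1 world of record; THIS file frames the three nodes that read the
construction `w.C` — N09 (`Dag.B12_main`), N11 (`Dag.B14_main`), N13 (`Dag.B16_main`) — over an ARBITRARY binding world,
so it imports the tree only (`DagBinding`) and is single-file checkable.  Kernel bookkeeping (`Iff.rfl` ∕ `rfl` ∕ one
`rw`); nothing of Bałaban's asserted; count-neutral; NOT proposed (R296).

WHAT IT RECORDS, in kernel form (for the Stage-5 design of `w₀` and for the referee's VACUITY STANDARD Q-N00-6 ∕ YM-PLAN §1):
* §1 `PaperInputs` ∕ `paperInputs w = (w.C, w.γ, w.em, w.ep, w.βup, w.β₀, w.up)` and `nodes_iff_of_paperInputs_eq`: the conjunction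
  of the thirteen paper nodes `DagBinding.Nodes (leavesP w P)` depends on `w` ONLY through these seven fields — the world's
  `b` (the UNPRINTED uniform lower bound of the β-functions, cell census T09.F), `L`, `gR` and the proof fields `β₀_pos b_pos one_lt_L`
  are read by NO paper node; they enter only the β-side leaves `thm2Regime running rgFlow betaSmoothBounded betaPositive` of `leavesP`,
  consumed by `DagBinding.B2_of_nodes` ∕ `torus_of_nodes` (binder territory, N24 ∕ B3–B4 of `continuumYM4_torus_of_BetaPertH`).
* §2 `b12_main_iff` ∕ `b14_main_iff` ∕ `b16_main_iff` (`Iff.rfl`): N09 ∕ N11 ∕ N13 at `(w, P)` UNFOLDED to the carrier leaves of `w.up P`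
  plus, respectively, `(w.C P).flow` & `(w.C P).IndAss` & `w.γ` (N09); `+ (w.C P).Sect2Form`, `w.βup`, `w.β₀` (N11); `+ (w.C P).Cfg ∕ χ ∕ ρ ∕
  wilsonBG ∕ numSites` through `B16.UVIneq`, `w.em`, `w.ep` (N13).
* §3 `b12_main_iff_of_leaves` ∕ `b14_main_iff_of_leaves` ∕ `b16_main_iff_of_leaves`: GIVEN the carrier leaves (what Stages 1–4 deliver at the
  objects of record), N09 ↔ `b12 ∧ (b12 → b13 → (InInterval γ K → ∀ k ≤ K, IndAss k))`, N11 ↔ `(… → IndAss) → (… → FlowIneq26) →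
  (rOperation → (… → Sect2Form))`, N13 ↔ `(… → IndAss) → (rOperation ∧ ((… → Sect2Form) → (… → UVIneq)))` — i.e. at the objects of record
  these three nodes are EXACTLY statements about the construction of record `w₀.C P : B16.RunData` (report §2.12: `IndAss k := Step.SFHyp …`,
  `Sect2Form k := Step.LFHyp …`, `ρ k := (R T)^k ρ₀`, `χ k`, `flow` forward-generated from `βfun`).
* §4 `smallFieldInductive_of_forall` ∕ `densitiesDescribed_of_forall` ∕ `b14_main_of_trivial_sect2Form` ∕ `b12_main_iff_of_trivial_indAss`: `B16.RunData.IndAss ∕ .Sect2Form` are `ℕ → Prop` FIELDS of the construction, so a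
  construction that sets them to `True` makes the conclusions of N09's third member and of N11 hold with no content — the located, kernel-checked
  form of report §2.12's sentence «D₀ = none yet … one more placeholder at which (B2) is false» and of the reason the plan's VACUITY GUARD and the
  referee's clause-by-clause reading of `w₀.C`'s definitions (bg lead R16 (ii)) are needed before any N09 ∕ N11 ∕ N13 booking «at objects».
HONEST FRAMING: dictionary ∕ bookkeeping only; no estimate, no claim about the series; one finite T⁴ programme, NOT continuum ∕ infinite volume ∕
OS ∕ mass gap ∕ Clay.
-/

namespace Literature.MathematicalPhysics.QuantumFieldTheory.Balaban1983to89.Node00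

open DagBinding

/-! ## §1. The paper-node inputs of a binding world -/

/-- **The PAPER-NODE INPUTS of a binding world**: the seven fields of `w : WorldP` that the thirteen paper nodes N01–N13 read —
the construction `C`, the coupling threshold `γ` ([Balaban1987RG1] Thm 1), the (2.50) exponent functions `em ep`
([Balaban1988Convergent] Cor. 3 p. 264), the flow-control constants `βup β₀` ((2.6) p. 255) and the upstream binding `up`.
Dictionary of printed constants, not a printed display. [cite: Balaban1988Convergent, Thm 1 p.262, (2.6) p.255, Cor. 3 (2.50) p.264; Balaban1987RG1, Thm 1 p.259 (the constants γ, β′, β₀, E₋(g_k), E₊(g_k) the node statements quantify — dictionary)] -/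
structure PaperInputs where
  /-- the construction `B12.RunParams → B16.RunData` -/
  C : B16.Construction
  /-- coupling threshold of the interval hypothesis -/
  γ : ℝ
  /-- (2.50) exponent functions of the running coupling -/
  em : ℝ → ℝ
  ep : ℝ → ℝ
  /-- uniform upper bound of the β-functions, and (2.6)'s `β₀` -/
  βup : ℝ
  β₀ : ℝ
  /-- the upstream (carrier-leaf) binding per run -/
  up : B12.RunParams → Upstream

/-- The paper-node inputs of `w`. [folklore] -/
def paperInputs (w : WorldP) : PaperInputs :=
  ⟨w.C, w.γ, w.em, w.ep, w.βup, w.β₀, w.up⟩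

/-- **The thirteen paper nodes read a world only through its paper-node inputs**: two binding worlds with the same
`(C, γ, em, ep, βup, β₀, up)` have the same `Nodes (leavesP · P)` at every run — whatever their `b`, `L`, `gR` (and proof fields).
So NODE 00's `w₀` owes the paper nodes exactly these seven objects; `b`, `L`, `gR` are β-side ∕ binder inputs
(`leavesP`'s `thm2Regime running rgFlow betaSmoothBounded betaPositive`, consumed by `B2_of_nodes` ∕ `torus_of_nodes`).
[cite: Balaban1987RG1, Thm 1 p.259 and Thm 3 p.264; Balaban1988Convergent, Thm 1 p.262, Cor. 3 p.264 (dictionary: which printed constants the node statements quantify)] -/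
theorem nodes_iff_of_paperInputs_eq {w w' : WorldP} (h : paperInputs w = paperInputs w') (P : B12.RunParams) :
    Nodes (leavesP w P) ↔ Nodes (leavesP w' P) := by
  obtain ⟨C, γ, em, ep, βup, β₀, _, b, _, L, _, gR, up⟩ := w
  obtain ⟨C', γ', em', ep', βup', β₀', _, b', _, L', _, gR', up'⟩ := w'
  simp only [paperInputs, PaperInputs.mk.injEq] at h
  obtain ⟨rfl, rfl, rfl, rfl, rfl, rfl, rfl⟩ := h
  exact Iff.rfl

/-- In particular the UNPRINTED positivity constant `b` (cell census T09.F: the uniform LOWER bound of the β-functions, whose existence is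
the open point of the series) is not an input of any paper node: replacing `w.b` by any positive real leaves N01–N13 unchanged at every run.
[cite: Balaban1987RG1, p.264 (the β-function bounds are deferred: «proof … in a separate paper»); dictionary ∕ bookkeeping] -/
theorem nodes_iff_of_b {w : WorldP} (b' : ℝ) (hb' : 0 < b') (P : B12.RunParams) :
    Nodes (leavesP w P) ↔ Nodes (leavesP { w with b := b', b_pos := hb' } P) :=
  nodes_iff_of_paperInputs_eq (w' := { w with b := b', b_pos := hb' }) rfl P

/-! ## §2. N09 ∕ N11 ∕ N13 unfolded at an arbitrary world (what they read of `w.C P`) -/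

section Unfolded

variable (w : WorldP) (P : B12.RunParams)

/-- **N09 · `Dag.B12_main` UNFOLDED**: over the carrier leaves of `w.up P` and — for its third member «Thm 1: interval hypothesis ⇒ inductive
assumptions» — the construction's flow `(w.C P).flow`, its inductive-assumption predicate `(w.C P).IndAss` and the threshold `w.γ`.
[cite: Balaban1987RG1, Thm 1 p.259, Thm 3 p.264 (dictionary, bookkeeping)] -/
theorem b12_main_iff :
    Dag.B12_main (leavesP w P) ↔
      ((w.up P).b4 → (w.up P).b5 → (w.up P).b6 → (w.up P).b7 → (w.up P).b8 → (w.up P).b9 → (w.up P).b10 →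
        (w.up P).b11 →
          ((w.up P).b12 ∧ ((w.up P).b12 → (w.up P).b13 →
            ((w.C P).flow.InInterval w.γ P.K → ∀ k, k ≤ P.K → (w.C P).IndAss k)))) :=
  Iff.rfl

/-- **N11 · `Dag.B14_main` UNFOLDED**: carrier leaves `b7 … b11`, `rOperation` of `w.up P`; of the construction: `flow` (interval hypothesis and
the flow control (2.6) `B14.FlowIneq26 (w.C P).flow.g w.βup w.β₀ P.K`), `IndAss`, `Sect2Form`; scalars `γ βup β₀`.
[cite: Balaban1988Convergent, Thm 1 p.262, Theorem p.245, (2.6) p.255 (dictionary, bookkeeping)] -/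
theorem b14_main_iff :
    Dag.B14_main (leavesP w P) ↔
      ((w.up P).b7 → (w.up P).b8 → (w.up P).b9 → (w.up P).b10 → (w.up P).b11 →
        ((w.C P).flow.InInterval w.γ P.K → ∀ k, k ≤ P.K → (w.C P).IndAss k) →
          ((w.C P).flow.InInterval w.γ P.K → B14.FlowIneq26 (w.C P).flow.g w.βup w.β₀ P.K) →
            ((w.up P).rOperation →
              ((w.C P).flow.InInterval w.γ P.K → ∀ k, k ≤ P.K → (w.C P).Sect2Form k))) :=
  Iff.rfl

/-- **N13 · `Dag.B16_main` UNFOLDED**: carrier leaves `b5 b6 b7 b9 b10 b11 b13`, `rBasicStep`, `rOperation` of `w.up P`; of the construction: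
`flow`, `IndAss`, `Sect2Form` and — through `B16.UVIneq (w.C P) k V (w.em (g_k)) (w.ep (g_k))` ((0.1) ∕ (2.50)) — `Cfg`, `χ`, `ρ`, `wilsonBG`,
`numSites`; scalars `γ` and the exponent FUNCTIONS `em ep`. [cite: Balaban1989LargeFieldII, Thm 1 and (0.1) p.355 (dictionary, bookkeeping)] -/
theorem b16_main_iff :
    Dag.B16_main (leavesP w P) ↔
      ((w.up P).b5 → (w.up P).b6 → (w.up P).b7 → (w.up P).b9 → (w.up P).b10 → (w.up P).b11 → (w.up P).b13 →
        (w.up P).rBasicStep →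
          ((w.C P).flow.InInterval w.γ P.K → ∀ k, k ≤ P.K → (w.C P).IndAss k) →
            ((w.up P).rOperation ∧
              (((w.C P).flow.InInterval w.γ P.K → ∀ k, k ≤ P.K → (w.C P).Sect2Form k) →
                ((w.C P).flow.InInterval w.γ P.K → ∀ k, k ≤ P.K → ∀ V : (w.C P).Cfg k,
                  B16.UVIneq (w.C P) k V (w.em ((w.C P).flow.g k)) (w.ep ((w.C P).flow.g k)))))) :=
  Iff.rfl

end Unfolded

/-! ## §3. N09 ∕ N11 ∕ N13 GIVEN the carrier leaves: statements about the construction of record alone -/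

section GivenLeaves

variable {w : WorldP} {P : B12.RunParams}

/-- **N09 once the carriers are pinned and their leaves hold** (Stages 1–4: `b4 … b11` at the objects of record): `Dag.B12_main (leavesP w P)`
is EXACTLY «`b12` (Sects. 2–5, over X's B12 group) and (`b12 → b13 →` Thm 1 for the construction `w.C P`: interval hypothesis on `(w.C P).flow`
⇒ the inductive assumptions `(w.C P).IndAss k`, `k ≤ K`)». [cite: Balaban1987RG1, Thm 1 p.259 (dictionary, bookkeeping)] -/
theorem b12_main_iff_of_leaves (h4 : (w.up P).b4) (h5 : (w.up P).b5) (h6 : (w.up P).b6) (h7 : (w.up P).b7)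
    (h8 : (w.up P).b8) (h9 : (w.up P).b9) (h10 : (w.up P).b10) (h11 : (w.up P).b11) :
    Dag.B12_main (leavesP w P) ↔
      ((w.up P).b12 ∧ ((w.up P).b12 → (w.up P).b13 →
        ((w.C P).flow.InInterval w.γ P.K → ∀ k, k ≤ P.K → (w.C P).IndAss k))) :=
  ⟨fun h => h h4 h5 h6 h7 h8 h9 h10 h11, fun h _ _ _ _ _ _ _ _ => h⟩

/-- **N11 once the carriers are pinned and their leaves hold** (`b7 … b11`): `Dag.B14_main (leavesP w P)` is a statement about `w.C P` (`flow`,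
`IndAss`, `Sect2Form`), the `rOperation` leaf of `w.up P` (`ROpLeaf V` under the X ∕ N-bindings) and the scalars `γ βup β₀` ONLY.
[cite: Balaban1988Convergent, Thm 1 p.262 (dictionary, bookkeeping)] -/
theorem b14_main_iff_of_leaves (h7 : (w.up P).b7) (h8 : (w.up P).b8) (h9 : (w.up P).b9) (h10 : (w.up P).b10)
    (h11 : (w.up P).b11) :
    Dag.B14_main (leavesP w P) ↔
      (((w.C P).flow.InInterval w.γ P.K → ∀ k, k ≤ P.K → (w.C P).IndAss k) →
        ((w.C P).flow.InInterval w.γ P.K → B14.FlowIneq26 (w.C P).flow.g w.βup w.β₀ P.K) →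
          ((w.up P).rOperation →
            ((w.C P).flow.InInterval w.γ P.K → ∀ k, k ≤ P.K → (w.C P).Sect2Form k))) :=
  ⟨fun h => h h7 h8 h9 h10 h11, fun h _ _ _ _ _ => h⟩

/-- **N13 once the carriers are pinned and their leaves hold** (`b5 b6 b7 b9 b10 b11 b13`, `rBasicStep`): `Dag.B16_main (leavesP w P)` is a
statement about `w.C P` (`flow`, `IndAss`, `Sect2Form`, and `Cfg χ ρ wilsonBG numSites` through `UVIneq`), the `rOperation` leaf and the scalars
`γ em ep` ONLY. [cite: Balaban1989LargeFieldII, Thm 1 and (0.1) p.355 (dictionary, bookkeeping)] -/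
theorem b16_main_iff_of_leaves (h5 : (w.up P).b5) (h6 : (w.up P).b6) (h7 : (w.up P).b7) (h9 : (w.up P).b9)
    (h10 : (w.up P).b10) (h11 : (w.up P).b11) (h13 : (w.up P).b13) (hR : (w.up P).rBasicStep) :
    Dag.B16_main (leavesP w P) ↔
      (((w.C P).flow.InInterval w.γ P.K → ∀ k, k ≤ P.K → (w.C P).IndAss k) →
        ((w.up P).rOperation ∧
          (((w.C P).flow.InInterval w.γ P.K → ∀ k, k ≤ P.K → (w.C P).Sect2Form k) →
            ((w.C P).flow.InInterval w.γ P.K → ∀ k, k ≤ P.K → ∀ V : (w.C P).Cfg k,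
              B16.UVIneq (w.C P) k V (w.em ((w.C P).flow.g k)) (w.ep ((w.C P).flow.g k)))))) :=
  ⟨fun h => h h5 h6 h7 h9 h10 h11 h13 hR, fun h _ _ _ _ _ _ _ _ => h⟩

end GivenLeaves

/-! ## §4. The vacuity the definitions of record must exclude (`IndAss` ∕ `Sect2Form` are FIELDS of the construction) -/

section Vacuity

variable (w : WorldP) (P : B12.RunParams)

/-- If the construction's inductive-assumption predicate at the run is trivially true at every step (`IndAss k` for all `k`, e.g. a
construction DEFINED with `IndAss := fun _ => True`), the world leaf `smallFieldInductive` — the conclusion of N09's Thm-1 member — holds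
with no content.  (Why «discharged at objects» for N09 needs `w₀.C`'s `IndAss` to BE the printed (0.23)–(0.29) hypotheses: report §2.12.)
[cite: Balaban1987RG1, (0.23)–(0.29) pp.256–258 (what the inductive assumptions are in print; bookkeeping)] -/
theorem smallFieldInductive_of_forall (h : ∀ k, (w.C P).IndAss k) : (leavesP w P).smallFieldInductive :=
  fun k _ => h k

/-- Likewise for N11's conclusion `densitiesDescribed` and the construction's `Sect2Form` field.
[cite: Balaban1988Convergent, Sect. 2 pp.252–264 (what the §2 description is in print; bookkeeping)] -/
theorem densitiesDescribed_of_forall (h : ∀ k, (w.C P).Sect2Form k) : (leavesP w P).densitiesDescribed :=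
  fun k _ => h k

/-- Hence at ANY world whose construction has `Sect2Form ≡ True` (pointwise) N11 holds outright, and with `IndAss ≡ True` N09's third member
holds and N09 reduces to «`b4 → … → b11 → b12`» (`b12_main_iff_of_trivial_indAss`): the kernel-checked reason a `B16.Construction` of record is
judged by the CONTENT of these two predicate fields (and of `ρ χ flow`), never by the node theorems alone. [cite: Balaban1988Convergent, Thm 1 p.262 (bookkeeping)] -/
theorem b14_main_of_trivial_sect2Form (hS : ∀ k, (w.C P).Sect2Form k) : Dag.B14_main (leavesP w P) :=
  fun _ _ _ _ _ _ _ _ _ k _ => hS k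

/-- (companion of `b14_main_of_trivial_sect2Form` for N09) [cite: Balaban1987RG1, Thm 1 p.259 (bookkeeping)] -/
theorem b12_main_iff_of_trivial_indAss (hI : ∀ k, (w.C P).IndAss k) :
    Dag.B12_main (leavesP w P) ↔
      ((w.up P).b4 → (w.up P).b5 → (w.up P).b6 → (w.up P).b7 → (w.up P).b8 → (w.up P).b9 → (w.up P).b10 →
        (w.up P).b11 → (w.up P).b12) :=
  ⟨fun h h4 h5 h6 h7 h8 h9 h10 h11 => (h h4 h5 h6 h7 h8 h9 h10 h11).1,
    fun h h4 h5 h6 h7 h8 h9 h10 h11 => ⟨h h4 h5 h6 h7 h8 h9 h10 h11, fun _ _ _ k _ => hI k⟩⟩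

end Vacuity

end Literature.MathematicalPhysics.QuantumFieldTheory.Balaban1983to89.Node00
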